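import Summits.CriticalPhenomena.PercolationContinuityZ3.Theorems.PercNearOneGluingNoHeavyLowerTailSureStarBridge
import HarnessLib

/-!
# `NoHeavyLowerTail` (stmt-CriticalPhenomena-4575) — the pre-FKG margin of a one-layer observer as a σ-law mixture of
# FORCED-STAR margins

Support file (lemma factory `prim-lf-3` gen 7, seat g9; `--supports stmt-CriticalPhenomena-4575`).  No definitions, no
named facts, no sorries.  Memo: `run/shared/lean/prim/prim-lf-3/LF3-BETA-R.md` §8 (assembly steps (1)–(2)).

`o` a one-layer observer with port set `Π` (`W s(o,u) = 0` for `u ∉ Π`, `u ≠ o`, and for the loop), `o ∉ A ⊇ Π`, `j, b ≠ o`.  With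
`σ_B = starEvent o B`, `π(B) = μ_W(σ_B)` (`real_starEvent_eq_prod`) and the forced star `W_B` (`1` on `s(o,p)`, `p ∈ B`, `0` on the other pairs at `o`):
* `real_obs_inter_starEvent`      — `μ_W(o↔b ∩ σ_B) = π(B)·μ_{W_B}(o↔b)`;
* `real_witness_inter_starEvent`  — `B ≠ ∅`: `μ_W((j↔b ∩ ⋃_{a∈A} o↔a) ∩ σ_B) = π(B)·μ_{W_B}(j↔b)`; `B = ∅`: it is `0`;
* `real_forcedStar_obs_empty`     — `μ_{W_∅}(o↔b) = 0`;
* `oneLayer_margin_eq_sum_forced` — `μ_W(o↔b) − μ_W(j↔b, o↔A) = Σ_{∅ ≠ B ⊆ Π} π(B)·[μ_{W_B}(o↔b) − μ_{W_B}(j↔b)]`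
  (Kozma–Nitzan's (41)-margin of the witness `j` at `o`, pattern by pattern; `BlockQ9`/`KNPreFKG` σ-law in forced form).
With `real_openConn_forcedStar_eq` each bracket is a difference of reliabilities of the CORE with the pattern glued.
-/

namespace Summit.CriticalPhenomena.PercolationContinuityZ3.Theorems

open MeasureTheory Set ProbabilityTheory
open Literature.Probability.LatticeModels
open Literature.Probability.Percolation

noncomputable section
open Classical

namespace UpsetExchange

variable {n : ℕ}

/-- The observer side of a star pattern. [cite: KozmaNitzan2024, proof of Thm. 4 (pp. 13–14)] -/
theorem real_obs_inter_starEvent (W : Sym2 (Fin n) → unitInterval) (o b : Fin n) (B : Finset (Fin n)) (hoB : o ∉ B)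
    (hloop : W s(o, o) = 0) :
    (prodBernoulli W).real (openConn o b ∩ starEvent o (↑B : Set (Fin n))) =
      (prodBernoulli W).real (starEvent o (↑B : Set (Fin n))) *
        (prodBernoulli (fun e : Sym2 (Fin n) => if o ∈ e then (if ∃ p ∈ B, e = s(o, p) then 1 else 0) else W e)).real
          (openConn o b) :=
  real_inter_starEvent_eq_mul_forced W o B hoB hloop (openConn o b)

/-- The witness side of a NONEMPTY star pattern: on `σ_B` the observer touches `A`. [cite: KozmaNitzan2024, proof of Thm. 4 (pp. 13–14)] -/
theorem real_witness_inter_starEvent (W : Sym2 (Fin n) → unitInterval) (A : Finset (Fin n)) (o j b : Fin n)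
    (B : Finset (Fin n)) (hoB : o ∉ B) (hBA : B ⊆ A) (hBne : B.Nonempty) (hloop : W s(o, o) = 0) :
    (prodBernoulli W).real ((openConn j b ∩ ⋃ a ∈ A, openConn o a) ∩ starEvent o (↑B : Set (Fin n))) =
      (prodBernoulli W).real (starEvent o (↑B : Set (Fin n))) *
        (prodBernoulli (fun e : Sym2 (Fin n) => if o ∈ e then (if ∃ p ∈ B, e = s(o, p) then 1 else 0) else W e)).real
          (openConn j b) := by
  have hset : (openConn j b ∩ ⋃ a ∈ A, openConn o a) ∩ starEvent o (↑B : Set (Fin n)) =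
      openConn j b ∩ starEvent o (↑B : Set (Fin n)) := by
    ext ω
    simp only [mem_inter_iff]
    constructor
    · rintro ⟨⟨h1, -⟩, h3⟩; exact ⟨h1, h3⟩
    · rintro ⟨h1, h3⟩
      refine ⟨⟨h1, ?_⟩, h3⟩
      obtain ⟨p, hp⟩ := hBne
      have hpo : p ≠ o := fun h => hoB (h ▸ hp)
      have hop : s(o, p) ∈ ω := ((mem_starEvent_iff o _ ω).1 h3 p hpo).2 (Finset.mem_coe.2 hp)
      exact mem_iUnion₂.2 ⟨p, hBA hp, ((openGraph_adj ω o p).2 ⟨hop, hpo.symm⟩).reachable⟩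
  rw [hset]
  exact real_inter_starEvent_eq_mul_forced W o B hoB hloop (openConn j b)

/-- The witness side of the EMPTY pattern vanishes: an observer with all its pairs closed touches nothing. [folklore] -/
theorem real_witness_inter_starEvent_empty (W : Sym2 (Fin n) → unitInterval) (A : Finset (Fin n)) (o j b : Fin n) (hoA : o ∉ A) :
    (prodBernoulli W).real ((openConn j b ∩ ⋃ a ∈ A, openConn o a) ∩ starEvent o (↑(∅ : Finset (Fin n)) : Set (Fin n))) = 0 := by
  have : ((openConn j b ∩ ⋃ a ∈ A, openConn o a) ∩ starEvent o (↑(∅ : Finset (Fin n)) : Set (Fin n))) = ∅ := by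
    ext ω
    simp only [Finset.coe_empty, mem_inter_iff, mem_empty_iff_false, iff_false, not_and]
    rintro ⟨-, hU⟩ hσ
    obtain ⟨a, ha, hoa⟩ := mem_iUnion₂.1 hU
    exact KNPreFKG.not_reachable_of_mem_starEvent_empty hσ (fun h => hoA (h ▸ ha)) hoa
  rw [this, measureReal_empty]

/-- Under the empty forced star the observer is isolated. [folklore] -/
theorem real_forcedStar_obs_empty (W : Sym2 (Fin n) → unitInterval) (o b : Fin n) (hbo : b ≠ o) :
    (prodBernoulli (fun e : Sym2 (Fin n) => if o ∈ e then (if ∃ p ∈ (∅ : Finset (Fin n)), e = s(o, p) then 1 else 0) else W e)).real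
        (openConn o b) = 0 := by
  refine real_openConn_isolated_eq_zero _ o (fun u _ => ?_) b hbo
  simp

/-- **The pre-FKG margin at a one-layer observer, pattern by pattern (forced form).**  See the module docstring.
[cite: KozmaNitzan2024, proof of Thm. 4 (pp. 13–14), Question 9 (p. 36)] -/
theorem oneLayer_margin_eq_sum_forced (W : Sym2 (Fin n) → unitInterval) (A P : Finset (Fin n)) (o j b : Fin n)
    (hoA : o ∉ A) (hPA : P ⊆ A) (hbo : b ≠ o)
    (hiso : ∀ u : Fin n, u ≠ o → u ∉ P → W s(o, u) = 0) (hloop : W s(o, o) = 0) :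
    (prodBernoulli W).real (openConn o b) - (prodBernoulli W).real (openConn j b ∩ ⋃ a ∈ A, openConn o a) =
      ∑ B ∈ P.powerset, if B = ∅ then 0 else
        (prodBernoulli W).real (starEvent o (↑B : Set (Fin n))) *
          ((prodBernoulli (fun e : Sym2 (Fin n) => if o ∈ e then (if ∃ p ∈ B, e = s(o, p) then 1 else 0) else W e)).real (openConn o b) -
            (prodBernoulli (fun e : Sym2 (Fin n) => if o ∈ e then (if ∃ p ∈ B, e = s(o, p) then 1 else 0) else W e)).real (openConn j b)) := by
  have hoP : o ∉ P := fun h => hoA (hPA h)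
  rw [KNPreFKG.real_eq_sum_inter_starEvent W P o hoP hiso (openConn o b),
    KNPreFKG.real_eq_sum_inter_starEvent W P o hoP hiso (openConn j b ∩ ⋃ a ∈ A, openConn o a), ← Finset.sum_sub_distrib]
  refine Finset.sum_congr rfl fun B hB => ?_
  have hBP : B ⊆ P := Finset.mem_powerset.1 hB
  have hoB : o ∉ B := fun h => hoP (hBP h)
  by_cases hBe : B = ∅
  · subst hBe
    rw [if_pos rfl, real_obs_inter_starEvent W o b ∅ hoB hloop, real_forcedStar_obs_empty W o b hbo,
      real_witness_inter_starEvent_empty W A o j b hoA, mul_zero, sub_zero]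
  · rw [if_neg hBe, real_obs_inter_starEvent W o b B hoB hloop,
      real_witness_inter_starEvent W A o j b B hoB (hBP.trans hPA) (Finset.nonempty_iff_ne_empty.2 hBe) hloop]
    ring

end UpsetExchange

end

end Summit.CriticalPhenomena.PercolationContinuityZ3.Theorems
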